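import Literature.AnabelianGeometry.SemiGraphs.ArithThm54CapstonesChart
import Literature.AnabelianGeometry.SemiGraphs.ArithThm54iiBindersOuterAction
import Literature.AnabelianGeometry.SemiGraphs.TemperedCosetTowerNoFixedBranchPairChart
import HarnessLib

/-!
# [SemiAnbd] Thm 5.4 (i) ∧ (ii) AT `π₁^temp(𝒢) ⋊^out Π_A` FOR A COFINAL GALOIS TOWER WITH CHARACTERISTIC FINITE
# LEVELS — every producer bound by name: `hP`, `hKst`, `hLst`, `hnobpNCpt`, `hR`, `hVE` all DISCHARGED

Mochizuki, *Semi-graphs of anabelioids*, Publ. RIMS **42** (2006) 221–322, §5 Thm 5.4 (i)(ii), manuscript p. 66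
(l. 50: "the proofs are entirely parallel to those of Theorem 3.7, Corollary 3.9"); Rmk 5.3.1 p. 65; Def 5.1 (i)
p. 62; Prop 3.6 (i)(ii)(iv) p. 38 [cite: MochizukiSemiAnbd2006, Thm 5.4 (i), p. 66].

PROOF-ONLY file (abc-iut cell, layer L3, producer row T54-B = `plan/GAP-LEDGER.md` G-w4d053-1; seat
abc-iut-w4-d029 gen 4, the capstone lineage, «T54·CAPSTONE-v3@char-tower»; recipes of abc-iut-L3-t9
2026-08-26T09:30:19Z / 09:45:04Z and abc-iut-w4-d053 09:40:52Z / 09:51:39Z).  No definition, no new named fact,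
no producer restated.

`ArithThm54CapstonesChart.lean` (this seat, p436174) states the T54-B capstones for the chart `D.chart` of an
ARBITRARY cofinal Galois tower `D` and, under CHARACTERISTIC finite levels
`hker : ∀ n, ker π_n = charOpenCore (π₁^temp of the tower) (d n)`, discharges the Φ-stability binders `hKst`/`hLst`
by abc-iut-L3-t9's E1 junction.  Here, IN ADDITION, every residual binder that is by now a THEOREM of the tree
GENERIC IN THE TOWER is bound BY NAME at the call site:

* `hP` := abc-iut-w4-d053's `isArithCompatible_piPresentation_outerAction_of_branchPair_chart_of_finite`
  (TemperedPiEdgeConjugatorsChart.lean p434016) from the design data `hV`/`hBR`;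
* `hKst`, `hLst` := abc-iut-L3-t9's `GaloisLevelData.hKst_and_hLst_of_ker_piLevelAut_eq_charOpenCore`
  (ArithTowerLevelStabilityJunction.lean p432096) from `hker`;
* `hnobpNCpt` := abc-iut-w4-d053's `hnobpNCpt_cosetTower_of_faithV_chart`
  (TemperedCosetTowerNoFixedBranchPairChart.lean p436328; abc-iut-w4-d083's producer, tower and chart
  generalised) from (I0v) for the tower, `hfaithV`;
* `hR` := abc-iut-w4-d040's `verticialEdgeLikeCompactAmple_outerAction_cosetTowerC` (generic in the chart and
  the presentation; ArithThm54iiBindersOuterAction.lean p432297) at THIS tower's package (`K n := ker ρ_n`,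
  `L n := ker π_n`, abc-iut-L3-d4/w4-d085's generic tower inputs);
* `hVE` := abc-iut-w4-d040/w4-d064's `not_isEdgeLike_of_isVerticial_outerAction_of_finite` (generic in the
  chart).

HONEST RESIDUAL of `arithMaximalCompactStatement_outerAction_piPresentation_chart_of_producers` (explicit
binders; owners as on the cell's T54 binder board): the tower binders `h𝒢 hcof hcn hS hfin hne hconn`
([SemiAnbd] Prop 3.6 for ANY cofinal tower; abc-iut-L3-t9's `ofCharCores_hcof`/`_hconn`,
`ofGaloisSeq_splits_self/isFinite/hasNonemptyFibres` at the characteristic tower); CHARACTERISTIC levels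
`hker` (abc-iut-L3-t9's `ker_piLevelAut_ofOpenNormalSeq_eq_charOpenCore` / `ker_piLevelAut_ofCharCores_eq_charOpenCore`,
p434994 / p435772 — oleans pending; bound in the sequel); (I0v) `hfaithV` for the tower (abc-iut-w4-d053's
`faithfulV_ofOpenNormalSeq`, p436328); the Prop 3.6 (iv)-at-`ρ_𝔾(a)` / Def 5.1 (i)(c) DESIGN data `hV`, `hE`,
`hopen`, `hBR`; the LEVEL-B topology on `E` (`hKopen`, `hT`, `hb`, `hK1′`; abc-iut-w6-d070's
`arithLevelTopology` terms); Thm 5.4's printed frame hypothesis `noSwitchBase` and its own hypotheses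
`hest`/`hbot`; (AI4″) `stabBranchPairAug` (abc-iut-w4-d059); the §5 frame `Π_A` compact, `E` Hausdorff; the
finite semi-graph `[Finite Vertex] [Finite Branch] [Finite Edge]`.  GONE w.r.t. the capstones: `hP`, `hKst`,
`hLst`, `hnobpNCpt`, `hR`, `hVE`.  Nothing beyond composition is proved here; typed ≠ proved for the residual
inputs; this is Thm 5.4 for OUR tower decomposition; no side taken on [IUTchIII] Cor. 3.12.
-/

namespace Literature.AnabelianGeometry.SemiGraphs

namespace ProfiniteSemiGraph

open CategoryTheory Topology Filter
open Literature.AnabelianGeometry.EtaleTheta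
open scoped Pointwise

universe u

variable {𝒢 : ProfiniteSemiGraph.{u}} (D : GaloisLevelData 𝒢) (h𝒢 : 𝒢.IsCountable)
  (hcof : ∀ (T : CovObj 𝒢), T.IsTempered → ∀ p : T.Point,
    ∃ i : ℕ, ∀ j, i ≤ j → (D.S j).Splits (T.component p))
  (hcn : 𝒢.graph.IsConnected) (hS : ∀ n, (D.S n).Splits (D.S n)) (hfin : ∀ n, (D.S n).IsFinite)
  (hne : ∀ n, (D.S n).HasNonemptyFibres)
  (hconn : ∀ (n : ℕ) (p q : (D.S n).Point), (D.S n).SameComponent p q)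

/-- **[SemiAnbd] Thm 5.4 (i) ∧ (ii) at `π₁^temp(𝒢) ⋊^out Π_A` for the chart of a cofinal Galois tower `D` with
CHARACTERISTIC finite levels — every landed producer bound by name** (`hP`, `hKst`, `hLst`, `hnobpNCpt`, `hR`,
`hVE` discharged; see the module docstring for the owner of each remaining binder).  For a finite graph `𝔾`
under the hypotheses of Thm 3.7, an outer action `ρ' : Π_A → Out π₁^temp(𝒢)` over a base action with its
Prop 3.6 (iv) / Def 5.1 (i)(c) data, characteristic finite levels `hker`, (I0v) `hfaithV` for the tower, the
level-B topology on `E`, Thm 5.4's frame `noSwitchBase` and hypotheses `hest`/`hbot`, and (AI4″)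
`stabBranchPairAug`: BOTH `ArithMaximalCompactStatementI` and `ArithMaximalCompactStatementII` hold for the produced
decomposition data `decompositionDataOfChart Rc ι` inside `E := π₁^temp(𝒢) ⋊^out_{ρ'} Π_A`.
[cite: MochizukiSemiAnbd2006, Thm 5.4 (i), p. 66] -/
theorem arithMaximalCompactStatement_outerAction_piPresentation_chart_of_producers
    (h37 : 𝒢.Thm37Hypotheses) (hG : 𝒢.graph.IsGraph) [Finite 𝒢.graph.Vertex] [Finite 𝒢.graph.Branch]
    [Finite 𝒢.graph.Edge]
    {PA : Type u} [Group PA] [TopologicalSpace PA] [IsTopologicalGroup PA] [CompactSpace PA]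
    (ρ' : PA →* TopOut (D.chart h𝒢 hcof hcn hS hfin hne).G) (baseAct : PA →* Aut 𝒢.graph)
    [TopologicalSpace (outerSemidirectProduct ρ')] [IsTopologicalGroup (outerSemidirectProduct ρ')]
    [T2Space (outerSemidirectProduct ρ')]
    (T : ∀ w : 𝒢.graph.Vertex, D.PointSeq h𝒢 w) (R : SemiGraph.RefBranches 𝒢.graph)
    (Rc : ChartRepresentatives (D.chart h𝒢 hcof hcn hS hfin hne))
    -- Prop 3.6 (iv) at `ρ_𝔾(a)` / Def 5.1 (i)(c): the DESIGN data of the outer model (abc-iut-w4-d082's currency)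
    (hV : ∀ (a : PA) (v : 𝒢.graph.Vertex) (H : Subgroup (D.chart h𝒢 hcof hcn hS hfin hne).G), H ∈ verticialSubgroups (D.chart h𝒢 hcof hcn hS hfin hne) v →
      ∃ φ : contMulAut (D.chart h𝒢 hcof hcn hS hfin hne).G, TopOut.mk _ φ = ρ' a ∧
        H.map (φ : MulAut (D.chart h𝒢 hcof hcn hS hfin hne).G).toMonoidHom ∈ verticialSubgroups (D.chart h𝒢 hcof hcn hS hfin hne) ((baseAct a).hom.vertexMap v))
    (hE : ∀ (a : PA) (e : 𝒢.graph.Edge) (K : Subgroup (D.chart h𝒢 hcof hcn hS hfin hne).G), K ∈ edgeLikeSubgroups (D.chart h𝒢 hcof hcn hS hfin hne) e →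
      ∃ φ : contMulAut (D.chart h𝒢 hcof hcn hS hfin hne).G, TopOut.mk _ φ = ρ' a ∧
        K.map (φ : MulAut (D.chart h𝒢 hcof hcn hS hfin hne).G).toMonoidHom ∈ edgeLikeSubgroups (D.chart h𝒢 hcof hcn hS hfin hne) ((baseAct a).hom.edgeMap e))
    (hopen : ∃ U : Subgroup PA, IsOpen (U : Set PA) ∧ ∀ a ∈ U,
      (∀ v, (baseAct a).hom.vertexMap v = v) ∧ (∀ e, (baseAct a).hom.edgeMap e = e) ∧
        ∀ b, (baseAct a).hom.branchMap b = b)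
    (hBR : ∀ (a : PA) (b : 𝒢.graph.Branch) (v : 𝒢.graph.Vertex) (hb : 𝒢.graph.abuts b = some v)
      (φ : 𝒢.Gv v →ₜ* (D.chart h𝒢 hcof hcn hS hfin hne).G), IsVerticialHom (D.chart h𝒢 hcof hcn hS hfin hne) v φ →
      ∃ Φ : contMulAut (D.chart h𝒢 hcof hcn hS hfin hne).G, TopOut.mk _ Φ = ρ' a ∧
        ∃ φ' : 𝒢.Gv ((baseAct a).hom.vertexMap v) →ₜ* (D.chart h𝒢 hcof hcn hS hfin hne).G,
          IsVerticialHom (D.chart h𝒢 hcof hcn hS hfin hne) ((baseAct a).hom.vertexMap v) φ' ∧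
          ∃ x' : (D.chart h𝒢 hcof hcn hS hfin hne).G,
            Subgroup.map (Φ : MulAut (D.chart h𝒢 hcof hcn hS hfin hne).G).toMonoidHom φ.toMonoidHom.range =
              Subgroup.map (MulAut.conj x').toMonoidHom φ'.toMonoidHom.range ∧
            Subgroup.map (Φ : MulAut (D.chart h𝒢 hcof hcn hS hfin hne).G).toMonoidHom
                (Subgroup.map φ.toMonoidHom (𝒢.branchSubgroup b v hb)) =
              Subgroup.map (MulAut.conj x').toMonoidHom
                (Subgroup.map φ'.toMonoidHom
                  (𝒢.branchSubgroup ((baseAct a).hom.branchMap b) ((baseAct a).hom.vertexMap v)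
                    ((baseAct a).hom.abuts_branchMap b v hb))))
    (w₀ : 𝒢.graph.Vertex)
    -- CHARACTERISTIC finite levels (abc-iut-L3-t9 E1): `ker π_n` is the characteristic open core of level `d n`
    (d : ℕ → ℕ) (hker : ∀ n, (D.piLevelAut h𝒢 hconn n).ker = charOpenCore (D.temperedPi h𝒢) (d n))
    -- (I0v) for the tower `D`: every `𝒢_v` acts faithfully on the `v`-fibres of the levels (abc-iut-w4-d053's
    -- `faithfulV_ofOpenNormalSeq` at the prescribed open-normal / characteristic tower)
    (hfaithV : ∀ (v : 𝒢.graph.Vertex) (h : 𝒢.Gv v),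
      (∀ (n : ℕ) (x : ((D.S n).SV v).obj.V), ((D.S n).SV v).obj.ρ h x = x) → h = 1)
    -- the LEVEL-B topology on `E` (abc-iut-w6-d070's `arithLevelTopology` terms, v2): tempered, abc-iut-L3-d2's
    -- neighbourhood basis, `hK1′`, open tree-level action kernels — all at the DERIVED `hP`/`hKst` terms
    (hT : IsTempered (outerSemidirectProduct ρ'))
    (hb : (𝓝 (1 : outerSemidirectProduct ρ')).HasBasis (fun _ : ℕ × OpenNormalSubgroup PA => True)
      (fun nU => (((D.piPresentation h𝒢 T R).levelKer (isArithCompatible_piPresentation_outerAction_of_branchPair_chart_of_finite D h𝒢 hcof hcn hS hfin hne T R ρ' baseAct h37 hG hV hBR)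
        (D.projAut h𝒢 nU.1).ker ((D.hKst_and_hLst_of_ker_piLevelAut_eq_charOpenCore h𝒢 hconn T R ρ' (isArithCompatible_piPresentation_outerAction_of_branchPair_chart_of_finite D h𝒢 hcof hcn hS hfin hne T R ρ' baseAct h37 hG hV hBR) d hker).1 nU.1) ⊓
        nU.2.toSubgroup.comap (outerSemidirectProductSnd ρ') : Subgroup (outerSemidirectProduct ρ')) :
          Set (outerSemidirectProduct ρ'))))
    (hK1' : ∀ n, IsOpen ((((D.piPresentation h𝒢 T R).levelKer (isArithCompatible_piPresentation_outerAction_of_branchPair_chart_of_finite D h𝒢 hcof hcn hS hfin hne T R ρ' baseAct h37 hG hV hBR)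
        (D.projAut h𝒢 n).ker ((D.hKst_and_hLst_of_ker_piLevelAut_eq_charOpenCore h𝒢 hconn T R ρ' (isArithCompatible_piPresentation_outerAction_of_branchPair_chart_of_finite D h𝒢 hcof hcn hS hfin hne T R ρ' baseAct h37 hG hV hBR) d hker).1 n)).map (outerSemidirectProductSnd ρ') :
      Subgroup PA) : Set PA))
    (hKopen : ∀ n, IsOpen (((D.piPresentation h𝒢 T R).arithAct (isArithCompatible_piPresentation_outerAction_of_branchPair_chart_of_finite D h𝒢 hcof hcn hS hfin hne T R ρ' baseAct h37 hG hV hBR) (D.projAut h𝒢 n).ker ((D.hKst_and_hLst_of_ker_piLevelAut_eq_charOpenCore h𝒢 hconn T R ρ' (isArithCompatible_piPresentation_outerAction_of_branchPair_chart_of_finite D h𝒢 hcof hcn hS hfin hne T R ρ' baseAct h37 hG hV hBR) d hker).1 n)).ker : Set (outerSemidirectProduct ρ')))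
    (noSwitchBase : NoBranchSwitching 𝒢.graph.edgeOf
      (fun (a : PA) (b : 𝒢.graph.Branch) => (baseAct a).hom.branchMap b))
    (stabBranchPairAug : ∀ (C : Subgroup (outerSemidirectProduct ρ')),
      IsCompact (C : Set (outerSemidirectProduct ρ')) →
      ∀ (j₀ : ℕ) (w : ∀ i : {i : ℕ // j₀ ≤ i}, ((D.piPresentation h𝒢 T R).cosetGraph (D.piLevelAut h𝒢 hconn i.1).ker).Vertex)
      (β β' : ∀ i : {i : ℕ // j₀ ≤ i}, ((D.piPresentation h𝒢 T R).cosetGraph (D.piLevelAut h𝒢 hconn i.1).ker).Branch),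
      (∀ i, β i ≠ β' i ∧ ((D.piPresentation h𝒢 T R).cosetGraph (D.piLevelAut h𝒢 hconn i.1).ker).abuts (β i) = some (w i) ∧
        ((D.piPresentation h𝒢 T R).cosetGraph (D.piLevelAut h𝒢 hconn i.1).ker).abuts (β' i) = some (w i)) →
      (∀ ⦃i i' : {i : ℕ // j₀ ≤ i}⦄ (h : i.1 ≤ i'.1),
        ((D.piPresentation h𝒢 T R).cosetGraphTrans (D.ker_piLevelAut_anti h𝒢 hconn h)).vertexMap (w i') = w i ∧
        ((D.piPresentation h𝒢 T R).cosetGraphTrans (D.ker_piLevelAut_anti h𝒢 hconn h)).branchMap (β i') = β i ∧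
          ((D.piPresentation h𝒢 T R).cosetGraphTrans (D.ker_piLevelAut_anti h𝒢 hconn h)).branchMap (β' i') = β' i) →
      (∀ (i : {i : ℕ // j₀ ≤ i}) (g : outerSemidirectProduct ρ'), g ∈ C →
        ((D.piPresentation h𝒢 T R).arithAct (isArithCompatible_piPresentation_outerAction_of_branchPair_chart_of_finite D h𝒢 hcof hcn hS hfin hne T R ρ' baseAct h37 hG hV hBR) (D.piLevelAut h𝒢 hconn i.1).ker ((D.hKst_and_hLst_of_ker_piLevelAut_eq_charOpenCore h𝒢 hconn T R ρ' (isArithCompatible_piPresentation_outerAction_of_branchPair_chart_of_finite D h𝒢 hcof hcn hS hfin hne T R ρ' baseAct h37 hG hV hBR) d hker).2 i.1) g).hom.vertexMap (w i) = w i ∧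
        ((D.piPresentation h𝒢 T R).arithAct (isArithCompatible_piPresentation_outerAction_of_branchPair_chart_of_finite D h𝒢 hcof hcn hS hfin hne T R ρ' baseAct h37 hG hV hBR) (D.piLevelAut h𝒢 hconn i.1).ker ((D.hKst_and_hLst_of_ker_piLevelAut_eq_charOpenCore h𝒢 hconn T R ρ' (isArithCompatible_piPresentation_outerAction_of_branchPair_chart_of_finite D h𝒢 hcof hcn hS hfin hne T R ρ' baseAct h37 hG hV hBR) d hker).2 i.1) g).hom.branchMap (β i) = β i ∧
          ((D.piPresentation h𝒢 T R).arithAct (isArithCompatible_piPresentation_outerAction_of_branchPair_chart_of_finite D h𝒢 hcof hcn hS hfin hne T R ρ' baseAct h37 hG hV hBR) (D.piLevelAut h𝒢 hconn i.1).ker ((D.hKst_and_hLst_of_ker_piLevelAut_eq_charOpenCore h𝒢 hconn T R ρ' (isArithCompatible_piPresentation_outerAction_of_branchPair_chart_of_finite D h𝒢 hcof hcn hS hfin hne T R ρ' baseAct h37 hG hV hBR) d hker).2 i.1) g).hom.branchMap (β' i) = β' i) →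
      ∃ (v : 𝒢.graph.Vertex) (b b' : 𝒢.graph.Branch) (a : PA) (h : outerSemidirectProduct ρ'),
        (decompositionDataOfChart Rc (toOuterSemidirectProduct ρ')).abut b = some v ∧ (decompositionDataOfChart Rc (toOuterSemidirectProduct ρ')).abut b' = some v ∧
        h ∈ (decompositionDataOfChart Rc (toOuterSemidirectProduct ρ')).vertGp v ∧ (b' ≠ b ∨ h ∉ (decompositionDataOfChart Rc (toOuterSemidirectProduct ρ')).brGp b) ∧
        C.map (outerSemidirectProductSnd ρ') ≤ conjSubgroup a (((decompositionDataOfChart Rc (toOuterSemidirectProduct ρ')).brGp b ⊓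
          conjSubgroup h ((decompositionDataOfChart Rc (toOuterSemidirectProduct ρ')).brGp b')).map (outerSemidirectProductSnd ρ')))
    (hest : IsTotallyArithEstranged (decompositionDataOfChart Rc (toOuterSemidirectProduct ρ')) (outerSemidirectProductSnd ρ')) (hbot : ¬ IsArithAmple (outerSemidirectProductSnd ρ') ⊥) :
    ArithMaximalCompactStatementI (decompositionDataOfChart Rc (toOuterSemidirectProduct ρ')) (outerSemidirectProductSnd ρ') ∧
      ArithMaximalCompactStatementII (decompositionDataOfChart Rc (toOuterSemidirectProduct ρ')) (outerSemidirectProductSnd ρ') := by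
  -- exactness of `1 → π₁^temp → E → Π_A → 1` (temp-slimness) at the chart of the tower
  obtain ⟨hι, hex, -⟩ := outerAction_exact (D.chart h𝒢 hcof hcn hS hfin hne) ρ' h37.toProp36Hypotheses
  have hιΦ : ∀ g : (D.chart h𝒢 hcof hcn hS hfin hne).G, (((contMulAut (D.chart h𝒢 hcof hcn hS hfin hne).G).subtype.comp (MonoidHom.fst (contMulAut (D.chart h𝒢 hcof hcn hS hfin hne).G) PA)).comp (outerSemidirectProduct ρ').subtype) ((toOuterSemidirectProduct ρ') g) = MulAut.conj g := fun _ => rfl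
  have hισ : ∀ g : (D.chart h𝒢 hcof hcn hS hfin hne).G, (baseAct.comp (outerSemidirectProductSnd ρ')) ((toOuterSemidirectProduct ρ') g) = 1 := fun g => by
    have hg : (toOuterSemidirectProduct ρ') g ∈ (outerSemidirectProductSnd ρ').ker := hex ▸ ⟨g, rfl⟩
    rw [MonoidHom.comp_apply, (MonoidHom.mem_ker).mp hg, map_one]
  have hPH : ∀ w, (D.piPresentation h𝒢 T R).H w ∈ verticialSubgroups (D.chart h𝒢 hcof hcn hS hfin hne) w := fun w => by
    rw [D.piPresentation_H h𝒢 T R]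
    exact (T w).range_decompHom_mem_verticialSubgroups_chart hcof hcn hS hfin hne
  -- `hnobpNCpt` (abc-iut-w4-d053's `_chart` transport of abc-iut-w4-d083's producer, mod (I0v) for `D`)
  have hnobpNCpt := hnobpNCpt_cosetTower_of_faithV_chart D h𝒢 hcof hcn hS hfin hne hconn T R h37
    (isArithCompatible_piPresentation_outerAction_of_branchPair_chart_of_finite D h𝒢 hcof hcn hS hfin hne T R ρ' baseAct h37 hG hV hBR)
    (D.hKst_and_hLst_of_ker_piLevelAut_eq_charOpenCore h𝒢 hconn T R ρ' (isArithCompatible_piPresentation_outerAction_of_branchPair_chart_of_finite D h𝒢 hcof hcn hS hfin hne T R ρ' baseAct h37 hG hV hBR) d hker).2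
    (toOuterSemidirectProduct ρ') hιΦ hισ hfaithV
  -- `hVE` (abc-iut-w4-d040 / abc-iut-w4-d064, generic in the chart)
  have hVE := not_isEdgeLike_of_isVerticial_outerAction_of_finite (D.chart h𝒢 hcof hcn hS hfin hne) ρ' baseAct h37 hG Rc hV hE hopen
  -- `hR` (abc-iut-w4-d040, generic in the chart and the presentation) at this tower's own package
  have hR := @verticialEdgeLikeCompactAmple_outerAction_cosetTowerC 𝒢 (D.chart h𝒢 hcof hcn hS hfin hne)
    PA _ _ ρ' baseAct _ _ _ _ h37 hG _ _ Rc hV hE hopen hBR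
    (D.piPresentation h𝒢 T R) _
    (isArithCompatible_piPresentation_outerAction_of_branchPair_chart_of_finite D h𝒢 hcof hcn hS hfin hne T R ρ' baseAct h37 hG hV hBR)
    hιΦ hPH
    (fun ε => piPresentation_M_mem_edgeLikeSubgroups_chart D h𝒢 hcof hcn hS hfin hne T R ε) w₀
    (fun n => (D.projAut h𝒢 n).ker) (fun _ => MonoidHom.normal_ker _) (D.ker_projAut_anti h𝒢)
    (D.hKst_and_hLst_of_ker_piLevelAut_eq_charOpenCore h𝒢 hconn T R ρ' (isArithCompatible_piPresentation_outerAction_of_branchPair_chart_of_finite D h𝒢 hcof hcn hS hfin hne T R ρ' baseAct h37 hG hV hBR) d hker).1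
    (D.piPresentation_hT h𝒢 T R) hKopen noSwitchBase
    (D.piPresentation_hHK h𝒢 T R) (D.piPresentation_hMK h𝒢 T R)
    (D.piPresentation_hlift h𝒢 T R) (D.piPresentation_hliftE h𝒢 T R)
    (fun n => (D.piLevelAut h𝒢 hconn n).ker) (fun _ => MonoidHom.normal_ker _)
    (fun j => D.finite_quotient_ker_piLevelAut h𝒢 hconn hfin j)
    (D.ker_piLevelAut_anti h𝒢 hconn)
    (D.hKst_and_hLst_of_ker_piLevelAut_eq_charOpenCore h𝒢 hconn T R ρ' (isArithCompatible_piPresentation_outerAction_of_branchPair_chart_of_finite D h𝒢 hcof hcn hS hfin hne T R ρ' baseAct h37 hG hV hBR) d hker).2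
    (fun n => D.ker_projAut_le_ker_piLevelAut h𝒢 hconn n)
    (D.piPresentation_hfree h𝒢 hconn T R) hnobpNCpt stabBranchPairAug hT hb hK1'
    (D.isOpen_ker_projAut h𝒢)
  exact arithMaximalCompactStatement_outerAction_piPresentation_chart_of_charLevels D h𝒢 hcof hcn hS hfin hne hconn
    h37 hG ρ' baseAct T R Rc
    (isArithCompatible_piPresentation_outerAction_of_branchPair_chart_of_finite D h𝒢 hcof hcn hS hfin hne T R ρ' baseAct h37 hG hV hBR)
    w₀ d hker hKopen noSwitchBase hnobpNCpt stabBranchPairAug hest hbot hR hVE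

end ProfiniteSemiGraph

end Literature.AnabelianGeometry.SemiGraphs
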